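import Literature.NumberTheory.EllipticCurves.PAdicBSDKatoFiniteProofs
import Literature.NumberTheory.EllipticCurves.HeegnerPointReflectionHolds
import HarnessLib

/-!
# bsd.S20, Kato's finiteness theorem for `L(E,1) ≠ 0`: Kolyvagin's route, down to printed inputs

Second sibling proof file of `Literature.NumberTheory.EllipticCurves.PAdicBSD` for the named fact
`Literature.NumberTheory.EllipticCurves.kato_finite_of_L_one_ne_zero` (K. Kato, *`p`-adic Hodge
theory and values of zeta functions of modular forms*, Astérisque 295 (2004), Thm. 14.2 (2) and
Cor. 14.3, p. 235, instance `A = E`, `K = ℚ`, `χ = 1`): for an elliptic curve `E/ℚ` and a prime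
`p`, `L(E, 1) ≠ 0 ⇒ E(ℚ)`, `Ш(E/ℚ)[p^∞]` and `Sel_{p^∞}(E/ℚ)` are finite.

`PAdicBSDKatoFiniteProofs` reduces the fact to bsd.S17
(`rank_eq_analyticRank_of_analyticRank_le_one`, Gross–Zagier–Kolyvagin in analytic rank `≤ 1`),
whose own reduction in the tree (`rank_eq_analyticRank_of_analyticRank_le_one_of_modularity''`,
`HeegnerPointReflectionHolds`) consumes six printed theorems, among them Waldspurger's
non-vanishing theorem for quadratic twists — needed only in analytic rank `1`. This file runs the
analytic-rank-`0` branch of that argument on its own, i.e. the original route by which the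
statement was first proved for modular elliptic curves (Kolyvagin 1988/1990, with the auxiliary
imaginary quadratic field supplied by Murty–Murty 1991 / Bump–Friedberg–Hoffstein 1990, and
Gross–Zagier 1986), as printed in Darmon, *Rational Points on Modular Elliptic Curves*, CBMS 101
(2004), §3.9, proof of Thm. 3.22, case `sign(E, ℚ) = +1`:

1. modularity (`hmod`, `existsUnique_isNewformOf`, Breuil–Conrad–Diamond–Taylor 2001) makes
   `L(E, s)` entire (`hasEntireLFunction_rat_of_modularity`), so `L(E,1) ≠ 0` means
   `ord_{s=1} L(E, s) = 0`, and gives the functional equation with sign `w(E)`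
   (`hasFunctionalEquationSign_rootNumber_of_modularity`, Hecke + Atkin–Lehner, both theorems of
   the tree via `isNewform0_exists_functional_equation_two_and`), whence `w(E) = +1` by parity
   (`WeierstrassCurve.even_analyticRank_iff_of_modularity`, `RootNumberModularityProofs`);
2. Murty–Murty (`hMM`, `murtyMurty_exists_heegnerField_twist_simpleZero`, Ann. of Math. 133
   (1991), Corollary p. 449): an imaginary quadratic `K` satisfying the Heegner hypothesis for
   `N_E` with `L(E^{(d_K)}, s)` having a simple zero at `s = 1`; hence
   `ord_{s=1} L(E/K, s) = 0 + 1 = 1` (`analyticRankEK_eq_add_of`) and `L'(E/K, 1) ≠ 0`;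
3. the Heegner point `P_K ∈ E(K)` (`hHP`, `exists_isHeegnerPoint`, Gross 1984) has infinite order
   by the Gross–Zagier formula (`hGZ`, `gross_zagier`;
   `not_isOfFinAddOrder_of_isHeegnerPoint_of_LDerivEK_ne_zero`);
4. Kolyvagin (`hKo`, `kolyvagin`, Kolyvagin 1990 Thm. A / Gross 1991 Thm. 1.3):
   `rank E(K) = 1` and `Ш(E/K)` finite; so `Ш(E/ℚ)` is finite
   (`shaFinite_of_shaFinite_baseChange_holds`);
5. Darmon's Prop. 3.11, a theorem of the tree (`heegnerPoint_conj_add_rootNumber_smul_holds`):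
   `σ P_K + w(E) P_K = σ P_K + P_K` is torsion for the reflection `σ` of `K`, so `E(ℚ)` has rank
   `0` (`mordellWeilRank_eq_zero_of_conjMap_add_isOfFinAddOrder`, with Mordell–Weil over `K`,
   `module_finite_point_holds`);
6. any model: pass to a global minimal model (`hasGlobalMinimalModel_rat_holds`) and transport
   `L`, rank and `Ш` (`analyticRank_variableChange_holds`, `mordellWeilRank_variableChange_holds`,
   `shaFinite_variableChange_iff_holds`);
7. `rank E(ℚ) = 0 ⇒ E(ℚ)` finite (Mordell–Weil, `finite_point_of_rank_zero`), `Ш(E/ℚ)` finite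
   `⇒ Ш(E/ℚ)[p^∞]` finite, and both `⇒ Sel_{p^∞}(E/ℚ)` finite
   (`finite_selmerGroupPInfty_of_finite`, `PAdicBSDKatoFiniteProofs`).

Result: `kato_finite_of_L_one_ne_zero_of_kolyvagin` — the fact for every elliptic `W/ℚ` and
prime `p` from exactly the five named inputs `hmod`, `hMM`, `hGZ`, `hHP`, `hKo`, each a single
primary theorem in print and each still an undischarged named fact of the tree; the trust base of
`kato_finite_of_L_one_ne_zero` is thereby contained in (and one input smaller than) that of
bsd.S17. Kato's own Euler-system proof (Astérisque 295, §§12–14) is independent of all five and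
is not formalised. Only theorems are added: no definition, no new named fact.

## References

* K. Kato, *`p`-adic Hodge theory and values of zeta functions of modular forms*, Astérisque 295
  (2004), 117–290, Thm. 14.2 (2) and Cor. 14.3 (p. 235). [Kato2004Asterisque]
* H. Darmon, *Rational Points on Modular Elliptic Curves*, CBMS 101 (2004), Prop. 3.11, Thm. 3.22
  and its proof, §3.9. [Darmon2004]
* V. A. Kolyvagin, *Finiteness of `E(ℚ)` and `Ш(E, ℚ)` for a subclass of Weil curves*, Izv. Akad.
  Nauk SSSR 52 (1988), 522–540; *Euler systems*, The Grothendieck Festschrift II, Progr. Math. 87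
  (1990), 435–483, Thm. A. [Kolyvagin1990]
* B. H. Gross, *Kolyvagin's work on modular elliptic curves*, in *`L`-functions and arithmetic*
  (Durham 1989), LMS Lecture Notes 153 (1991), 235–256, (1.1) and Thm. 1.3. [Gross1991]
* M. R. Murty, V. K. Murty, *Mean values of derivatives of modular `L`-series*, Ann. of Math. 133
  (1991), 447–475, Corollary p. 449. [MurtyMurty1991]
* B. H. Gross, D. Zagier, *Heegner points and derivatives of `L`-series*, Invent. Math. 84 (1986),
  225–320, Thm. I.6.3. [GrossZagierInvent1986]
-/

noncomputable section

open scoped Classical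

namespace Literature.NumberTheory.EllipticCurves

open WeierstrassCurve WeierstrassCurve.QuadraticDescent ModularForms

/-- **The Heegner field in analytic rank `0`, from Murty–Murty alone** (Darmon 2004, §3.9, proof of
Thm. 3.22, items (1)–(2), case `sign(E, ℚ) = +1`). If `L(W, s)` is entire for every elliptic `W/ℚ`
(`hE`, modularity) and Murty–Murty's corollary holds (`hMM`: for `L(W, 1) ≠ 0` an imaginary
quadratic `K` with the Heegner hypothesis for `N_W` and `L(W^{(d_K)}, s)` having a simple zero at
`s = 1`), then every elliptic `W/ℚ` with `L(W, 1) ≠ 0` has such a `K` with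
`ord_{s=1} L(W/K, s) = 1`: indeed `ord L(W) = 0` (`analyticRank_eq_zero_iff_holds`),
`ord L(W^{(d_K)}) = 1` (`AnalyticAt.analyticOrderAt_eq_one_of_zero_deriv_ne_zero`) and the orders
add (`analyticRankEK_eq_add_of`). This is the `r = 0` half of
`exists_heegnerField_analyticRankEK_eq_one_of` (`LeadingTermProofs`), which needs neither parity
nor Waldspurger. [cite: Darmon2004, §3.9, proof of Thm. 3.22, (1)–(2)] -/
theorem exists_heegnerField_analyticRankEK_eq_one_of_L_one_ne_zero (hE : hasEntireLFunction_rat)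
    (hMM : murtyMurty_exists_heegnerField_twist_simpleZero) (W : WeierstrassCurve ℚ)
    [W.IsElliptic] (hL : W.entireLFunction 1 ≠ 0) :
    ∃ (K : Type) (_ : Field K) (_ : NumberField K),
      IsImaginaryQuadratic K ∧ SatisfiesHeegnerHypothesis (W.conductorNorm ℤ) K ∧
        analyticRankEK W K = 1 := by
  have h0 : W.analyticRank = 0 := (W.analyticRank_eq_zero_iff_holds (hE W)).mpr hL
  obtain ⟨K, _, _, hKq, hH, h0', h1'⟩ := hMM.exists W hL
  refine ⟨K, _, _, hKq, hH, ?_⟩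
  have hd : (NumberField.discr K : ℚ) ≠ 0 := by exact_mod_cast NumberField.discr_ne_zero K
  haveI := W.isElliptic_quadraticTwist hd
  set W' := W.quadraticTwist (NumberField.discr K : ℚ) with hW'
  have hg : AnalyticAt ℂ W'.entireLFunction 1 :=
    (W'.differentiable_entireLFunction (hE W')).analyticAt 1
  have htw : W'.analyticRank = 1 := by
    have h1 := hg.analyticOrderAt_eq_one_of_zero_deriv_ne_zero h0' h1'
    simp only [WeierstrassCurve.analyticRank, analyticOrderNatAt, h1]
    rfl
  rw [analyticRankEK_eq_add_of hE, h0, htw]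

/-- **Kolyvagin's finiteness theorem in analytic rank `0`, for a globally minimal model, from the
primary theorems in print** (Kolyvagin 1988/1990; Darmon 2004, §3.9, proof of Thm. 3.22, case
`sign(E, ℚ) = +1`). For a globally minimal elliptic `W/ℚ` with `L(W, 1) ≠ 0`:
`rank_ℤ W(ℚ) = 0` and `Ш(W/ℚ)` is finite, assuming modularity (`hmod`, BCDT 2001), Murty–Murty's
twist with a simple zero (`hMM`, 1991, Corollary p. 449), the Gross–Zagier formula (`hGZ`,
`gross_zagier`), Heegner points over `K` (`hHP`, `exists_isHeegnerPoint`, Gross 1984) and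
Kolyvagin's theorem (`hKo`, `kolyvagin`, 1990 Thm. A). Proof: steps 1–5 of the module docstring —
the Heegner field `K` with `ord L(W/K) = 1`
(`exists_heegnerField_analyticRankEK_eq_one_of_L_one_ne_zero`), `L'(W/K, 1) ≠ 0`
(`LDerivEK_ne_zero_of_analyticRankEK_eq_one`), `P_K` of infinite order by Gross–Zagier, Kolyvagin
over `K`, descent of `Ш` (`shaFinite_of_shaFinite_baseChange_holds`), `w(W) = +1` by parity
(`WeierstrassCurve.even_analyticRank_iff_of_modularity`, Hecke and Atkin–Lehner being theorems of
the tree, `isNewform0_exists_functional_equation_two_and`), Prop. 3.11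
(`heegnerPoint_conj_add_rootNumber_smul_holds`) and the rank descent
`mordellWeilRank_eq_zero_of_conjMap_add_isOfFinAddOrder` (Mordell–Weil over `K`,
`module_finite_point_holds`). [cite: Darmon2004, Thm. 3.22 and §3.9 (case sign +1)] -/
theorem mordellWeilRank_eq_zero_and_finite_sha_of_isGloballyMinimal_of_kolyvagin
    (hmod : existsUnique_isNewformOf)
    (hMM : murtyMurty_exists_heegnerField_twist_simpleZero)
    (hGZ : ∀ (N : ℕ) [NeZero N] (W : WeierstrassCurve ℚ) (K : Type) [Field K] [NumberField K],
      gross_zagier N W K)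
    (hHP : ∀ (W : WeierstrassCurve ℚ) (K : Type) [Field K] [NumberField K],
      exists_isHeegnerPoint W K)
    (hKo : ∀ (N : ℕ) [NeZero N] (W : WeierstrassCurve ℚ) (K : Type) [Field K] [NumberField K],
      kolyvagin N W K)
    (W : WeierstrassCurve ℚ) [W.IsElliptic] [W.IsGloballyMinimal] (hL : W.entireLFunction 1 ≠ 0) :
    W.mordellWeilRank = 0 ∧ Finite W.sha := by
  haveI : NeZero (W.conductorNorm ℤ) := ⟨(W.conductorNorm_pos_holds).ne'⟩
  have hE : hasEntireLFunction_rat := hasEntireLFunction_rat_of_modularity hmod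
  have h0 : W.analyticRank = 0 := (W.analyticRank_eq_zero_iff_holds (hE W)).mpr hL
  -- (2) the Heegner field, `L'(W/K, 1) ≠ 0`
  obtain ⟨K, _, _, hKq, hH, hr⟩ :=
    exists_heegnerField_analyticRankEK_eq_one_of_L_one_ne_zero hE hMM W hL
  have hLK : LDerivEK W K ≠ 0 := LDerivEK_ne_zero_of_analyticRankEK_eq_one W K hr
  -- (3) the Heegner point, of infinite order by Gross–Zagier; (4) Kolyvagin over `K`
  obtain ⟨P, hP⟩ := hHP W K hKq hH
  have hPnt : ¬ IsOfFinAddOrder P :=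
    not_isOfFinAddOrder_of_isHeegnerPoint_of_LDerivEK_ne_zero (hGZ _ W K hKq hH) hP hLK
  obtain ⟨hrkK, hshaK⟩ := hKo _ W K hKq hH hP hPnt
  refine ⟨?_, shaFinite_of_shaFinite_baseChange_holds W K hshaK⟩
  -- (5) the reflection of `K`, `w(W) = +1`, Prop. 3.11 and the rank descent
  obtain ⟨θ, c, hθ, hc⟩ :=
    Literature.NumberTheory.QuadraticFields.Quadratic.exists_sq_eq_algebraMap (F := ℚ) (K := K)
      hKq.1
  have hσ : Literature.NumberTheory.QuadraticFields.Quadratic.conj hKq.1 hθ hc ≠ AlgHom.id ℚ K := by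
    intro hid
    have h1 : Literature.NumberTheory.QuadraticFields.Quadratic.conj hKq.1 hθ hc θ = -θ :=
      Literature.NumberTheory.QuadraticFields.Quadratic.conj_gen hKq.1 hθ hc
    rw [hid, AlgHom.id_apply] at h1
    have h2θ : (2 : K) * θ = 0 := by linear_combination h1
    exact Literature.NumberTheory.QuadraticFields.Quadratic.ne_zero_of_not_mem_range hθ
      ((mul_eq_zero.mp h2θ).resolve_left two_ne_zero)
  have hpar : W.even_analyticRank_iff :=
    W.even_analyticRank_iff_of_modularity hmod
      (fun N _ ↦ (isNewform0_exists_functional_equation_two_and N).1)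
      (fun N _ ↦ (isNewform0_exists_functional_equation_two_and N).2)
  have hw : W.rootNumber = 1 := hpar.mp (by rw [h0]; exact Even.zero)
  have hT := heegnerPoint_conj_add_rootNumber_smul_holds W K hKq hH hP _ hσ
  rw [hw, one_zsmul] at hT
  haveI : (W.baseChange K).IsElliptic := by rw [baseChange]; infer_instance
  have hfinK : Module.Finite ℤ (W.baseChange K).toAffine.Point :=
    (W.baseChange K).module_finite_point_holds
  exact mordellWeilRank_eq_zero_of_conjMap_add_isOfFinAddOrder W hfinK hrkK _ hPnt hT

/-- **Kolyvagin's finiteness theorem in analytic rank `0`, any model** (Kolyvagin 1988/1990;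
Darmon 2004, Thm. 3.22, case `ord_{s=1} L(E, s) = 0`): for an elliptic `W/ℚ` with `L(W, 1) ≠ 0`,
`rank_ℤ W(ℚ) = 0` and `Ш(W/ℚ)` is finite, from the five inputs of
`mordellWeilRank_eq_zero_and_finite_sha_of_isGloballyMinimal_of_kolyvagin`, by passage to a global
minimal model (`hasGlobalMinimalModel_rat_holds`): `L(W, 1) ≠ 0` is `ord = 0`
(`analyticRank_eq_zero_iff_holds`, `L` entire by modularity), and `ord`, rank and the finiteness of
`Ш` are invariant under admissible changes of variables (`analyticRank_variableChange_holds`,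
`mordellWeilRank_variableChange_holds`, `shaFinite_variableChange_iff_holds`).
[cite: Darmon2004, Thm. 3.22 and §3.9 (case sign +1)] -/
theorem mordellWeilRank_eq_zero_and_finite_sha_of_L_one_ne_zero_of_kolyvagin
    (hmod : existsUnique_isNewformOf)
    (hMM : murtyMurty_exists_heegnerField_twist_simpleZero)
    (hGZ : ∀ (N : ℕ) [NeZero N] (W : WeierstrassCurve ℚ) (K : Type) [Field K] [NumberField K],
      gross_zagier N W K)
    (hHP : ∀ (W : WeierstrassCurve ℚ) (K : Type) [Field K] [NumberField K],
      exists_isHeegnerPoint W K)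
    (hKo : ∀ (N : ℕ) [NeZero N] (W : WeierstrassCurve ℚ) (K : Type) [Field K] [NumberField K],
      kolyvagin N W K)
    (W : WeierstrassCurve ℚ) [W.IsElliptic] (hL : W.entireLFunction 1 ≠ 0) :
    W.mordellWeilRank = 0 ∧ Finite W.sha := by
  have hE : hasEntireLFunction_rat := hasEntireLFunction_rat_of_modularity hmod
  have h0 : W.analyticRank = 0 := (W.analyticRank_eq_zero_iff_holds (hE W)).mpr hL
  obtain ⟨C, hC⟩ := hasGlobalMinimalModel_rat_holds W
  haveI := hC
  have hanC : (C • W).analyticRank = 0 := (analyticRank_variableChange_holds W C).trans h0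
  have hLC : (C • W).entireLFunction 1 ≠ 0 :=
    ((C • W).analyticRank_eq_zero_iff_holds (hE (C • W))).mp hanC
  obtain ⟨hr, hs⟩ :=
    mordellWeilRank_eq_zero_and_finite_sha_of_isGloballyMinimal_of_kolyvagin hmod hMM hGZ hHP hKo
      (C • W) hLC
  refine ⟨?_, (shaFinite_variableChange_iff_holds W C).mp hs⟩
  rwa [mordellWeilRank_variableChange_holds W C] at hr

/-- **bsd.S20, Kato's finiteness theorem, by Kolyvagin's route from the primary theorems in
print.** For an elliptic curve `E/ℚ` (any model `W`) and a prime `p`,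
`kato_finite_of_L_one_ne_zero W p` — `L(E, 1) ≠ 0 ⇒ E(ℚ)`, `Ш(E/ℚ)[p^∞]` and `Sel_{p^∞}(E/ℚ)`
finite (Kato, Astérisque 295 (2004), Thm. 14.2 (2) / Cor. 14.3, p. 235, case `A = E`, `K = ℚ`,
`χ = 1`) — from exactly: modularity in Version `L` (`hmod`, `existsUnique_isNewformOf`,
Breuil–Conrad–Diamond–Taylor 2001, Thm. A); Murty–Murty's quadratic twist with a simple zero
(`hMM`, `murtyMurty_exists_heegnerField_twist_simpleZero`, Ann. of Math. 133 (1991), Corollary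
p. 449; also Bump–Friedberg–Hoffstein 1990); the Gross–Zagier formula (`hGZ`, `gross_zagier`,
Invent. Math. 84 (1986), Thm. I.6.3, in the form of Cai–Shu–Tian 2014, Thm. 1.1); Heegner points
are `K`-rational (`hHP`, `exists_isHeegnerPoint`, Gross 1984 / GZ86 I.§4); Kolyvagin's theorem
(`hKo`, `kolyvagin`, Kolyvagin 1990 Thm. A / Gross 1991 Thm. 1.3). Proof:
`mordellWeilRank_eq_zero_and_finite_sha_of_L_one_ne_zero_of_kolyvagin` gives `rank E(ℚ) = 0` and
`Ш(E/ℚ)` finite; then `E(ℚ)` is finite by Mordell–Weil (`finite_point_of_rank_zero`),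
`Ш(E/ℚ)[p^∞] ≤ Ш(E/ℚ)` is finite, and `Sel_{p^∞}(E/ℚ)` is finite by
`finite_selmerGroupPInfty_of_finite` (`PAdicBSDKatoFiniteProofs`). This is how the statement was
first proved for modular `E` (Kolyvagin 1988), before and independently of Kato's Euler-system
proof, which is not formalised. [cite: Kato2004Asterisque, Thm. 14.2 (2) and Cor. 14.3 (p. 235)] -/
theorem kato_finite_of_L_one_ne_zero_of_kolyvagin
    (hmod : existsUnique_isNewformOf)
    (hMM : murtyMurty_exists_heegnerField_twist_simpleZero)
    (hGZ : ∀ (N : ℕ) [NeZero N] (W : WeierstrassCurve ℚ) (K : Type) [Field K] [NumberField K],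
      gross_zagier N W K)
    (hHP : ∀ (W : WeierstrassCurve ℚ) (K : Type) [Field K] [NumberField K],
      exists_isHeegnerPoint W K)
    (hKo : ∀ (N : ℕ) [NeZero N] (W : WeierstrassCurve ℚ) (K : Type) [Field K] [NumberField K],
      kolyvagin N W K)
    (W : WeierstrassCurve ℚ) [W.IsElliptic] (p : ℕ) [Fact p.Prime] :
    kato_finite_of_L_one_ne_zero W p := by
  intro hL
  obtain ⟨hrank, hsha⟩ :=
    mordellWeilRank_eq_zero_and_finite_sha_of_L_one_ne_zero_of_kolyvagin hmod hMM hGZ hHP hKo W hL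
  haveI : Finite W.toAffine.Point := W.finite_point_of_rank_zero hrank
  haveI : Finite W.sha := hsha
  exact ⟨inferInstance, inferInstance, W.finite_selmerGroupPInfty_of_finite p⟩

/-- **bsd.S20 from its five NAMED-FACT leaves** (fact decomposition of
`kato_finite_of_L_one_ne_zero`, librarian sweep `libsplit-39`, 2026-08-16). The statement of
Kato's finiteness theorem for every elliptic `W/ℚ` and prime `p` (Kato 2004, Thm. 14.2 (2) /
Cor. 14.3: `L(E, 1) ≠ 0 ⇒ E(ℚ)`, `Ш(E/ℚ)[p^∞]`, `Sel_{p^∞}(E/ℚ)` finite) is PROVED in the tree from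
exactly five undischarged named facts, each a single primary theorem in print — modularity in
Version `L` (`existsUnique_isNewformOf`, Breuil–Conrad–Diamond–Taylor 2001), Murty–Murty's twist
with a simple zero (`murtyMurty_exists_heegnerField_twist_simpleZero`, Ann. of Math. 133 (1991)),
the Gross–Zagier formula (`gross_zagier`), `K`-rationality of Heegner points
(`exists_isHeegnerPoint`) and Kolyvagin's theorem (`kolyvagin`) — by
`kato_finite_of_L_one_ne_zero_of_kolyvagin` (this file: Kolyvagin's analytic-rank-`0` route,
Darmon 2004 §3.9). This is that theorem under the tree's `…_holds_of` name, so that the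
discharge of bsd.S20 reads `kato_finite_of_L_one_ne_zero_holds_of hmod_holds hMM_holds hGZ_holds
hHP_holds hKo_holds W p` once the five leaves land; Kato's own Euler-system proof (Astérisque 295,
§§12–14: Beilinson–Kato zeta elements) remains unformalised and is the alternative direct route.
[cite: Kato2004Asterisque, Thm. 14.2 (2) and Cor. 14.3 (p. 235)] -/
theorem kato_finite_of_L_one_ne_zero_holds_of
    (hmod : existsUnique_isNewformOf)
    (hMM : murtyMurty_exists_heegnerField_twist_simpleZero)
    (hGZ : ∀ (N : ℕ) [NeZero N] (W : WeierstrassCurve ℚ) (K : Type) [Field K] [NumberField K],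
      gross_zagier N W K)
    (hHP : ∀ (W : WeierstrassCurve ℚ) (K : Type) [Field K] [NumberField K],
      exists_isHeegnerPoint W K)
    (hKo : ∀ (N : ℕ) [NeZero N] (W : WeierstrassCurve ℚ) (K : Type) [Field K] [NumberField K],
      kolyvagin N W K)
    (W : WeierstrassCurve ℚ) [W.IsElliptic] (p : ℕ) [Fact p.Prime] :
    kato_finite_of_L_one_ne_zero W p :=
  kato_finite_of_L_one_ne_zero_of_kolyvagin hmod hMM hGZ hHP hKo W p

end Literature.NumberTheory.EllipticCurves

end
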